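/-
Width seat `ym-line-cbag-p1-w3` (prover-ym-line-cbag-p1-w3-g4-0), route `ColdBoxAllGroups` (planner-of-record ym-idea-2), glue for the
CLOSED crux `BoxFloorAllGroups` (stmt-QuantumFields-22254): the torus-side PHYSICAL reading of the route's two proved cruxes for every compact
simple gauge group — PW-CORR-POLY(G) — and the single-plaquette form of lattice non-freezing.  RECORD-label rung material only (R2xi-G);
the Yang–Mills mass gap is NOT proved by anything here.
-/
import Summits.QuantumFields.YangMills.Theorems.ColdBoxAllGroupsXiPow
import Summits.QuantumFields.YangMills.Theorems.SoloInformedNonFreezingFloor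
import Literature.MathematicalPhysics.QuantumLattice.LatticeGaugeDLRCovarianceSplit

/-!
# Route `ColdBoxAllGroups`, glue: the volume-uniform power-law floor of the torus plaquette–plaquette correlator,
# for EVERY compact simple `G` (PW-CORR-POLY(G)), and single-plaquette non-freezing

The route's two cruxes are tree theorems — `BoxFloorAllGroups_proof` (stmt-QuantumFields-22254: Gaussian domination of the two-plaquette
covariance in a cold-wall box, below an exponent ceiling) and `BulkAllGroups_proof` (stmt-QuantumFields-22255: the torus states dominate a
fixed fraction of the box covariance, under every ceiling) — and the rung leaf `XiPow` followed (`xiPow_holds`).  The leaf is phrased in the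
RP-spectral currency (`MassGapPowerDecayOf`: an UPPER bound `β^{-ε}` on the transfer-matrix gap of every torus-limit state).  This file records
the STRONGER torus-side statement the same two cruxes give through the tree's proved glue `polySeparationPlaquetteFloor_of_box` and FLOOR
`curvatureCorrPowerFloor_proof`, i.e. the physical content of the route, and its reading in the currency of the OPEN node `LatticeNonFreezing`
(`SoloInformedNonFreezing`):

* `torusPlaquetteFloor_allGroups_ceiling` / `torusPlaquetteFloor_allGroups` — **PW-CORR-POLY for every compact simple `G`**: for every
  faithful unitary lattice representation `r` (and under every exponent ceiling `θ₀ > 0`) there are `0 < A (< θ₀)` and `κ > 0` with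
  `PolySeparationPlaquetteFloor 4 r.ρ 1 2 A κ`: for all large `β` and all large tori `Λ_{L+1}`, the connected correlator of the `(1,2)`-plaquette
  cost `N − Re tr r(U_p)` at the origin and its time-translate by `⌈β^A⌉` is `≥ κ β^{-(2+8A)}`, UNIFORMLY IN THE VOLUME.  This is, verbatim, the
  hypothesis `H` of `SteinGapBootstrap.SteinBlockTransferG_of_polySeparationFloorAllG` (route `SteinGapBootstrap`, closed superseded) and the
  shape consumed by the `…FloorOf…` glue of routes `EntropyBudgetEquipartition` / `SourcedPressureJensen`.
* `torusPlaqCov_eq_latticeConnectedCorr` — dictionary: the rates currency `torusPlaqCov ρ β L T i j` IS the OS-data currency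
  `latticeConnectedCorr ρ β (L+1) (plaqCost0 ρ i j) (plaqCost0 ρ i j) T` (translation invariance of the torus Wilson state, tree
  `integral_comp_configShift_torusLift`).
* `plaquettePolynomialFloor_allGroups` and `plaquetteNonFreezing_allGroups` — the statements `PolynomialFloorWitness` and `LatticeNonFreezing`
  of `SoloInformedNonFreezingFloor` / `SoloInformedNonFreezing` with the curvature species `r.curvature.F` (the SIX-plane action density)
  replaced by the single spatial plaquette cost `plaqCost0 r.ρ 1 2`, PROVED for every compact simple `G`: at all large `β`, on every large
  periodic torus of side `2S+1`, the pair (origin plaquette, its translate by `n = ⌈β^A⌉ ≤ S` in time) has truncated correlation `> C e^{-μ n}`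
  for any prescribed `C` and rate `μ > 0` — the `(1,2)`-plaquette field does not cluster at any fixed exponential rate, uniformly in the volume,
  as `β → ∞` (polynomial floor at polynomial separation beats every exponential; the arithmetic is that of `latticeNonFreezing_of_polynomialFloor`).

WHAT IS NOT PROVED HERE (planner note).  The node `LatticeNonFreezing` AS TYPED concerns `r.curvature.F = actionDensity r.ρ`, the sum of the
plaquette observables over all six planes at the origin; its connected correlator with a translate is the sum of the 36 plane-pair covariances,
of which the route's engine controls the `(1,2)×(1,2)` (equivalently any spatial-diagonal) term from below.  The cross-plane and temporal-plane
terms would need the same one-scale expansion in TWO-SIDED form for general plane pairs (free two-gluon exchange predicts each of them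
non-negative, `≈ β^{-2}·(field-strength two-point)²`); that is a crux-sized extension («all planes cold box»), not glue, and is not attempted.
HONEST FRAMING: every statement here is an assertion that correlations are LARGE (lower bounds on covariances / upper bounds on gaps), the
trivial half of asymptotic scaling; nothing bears on the Clay mass gap; no summit statement is proved.  No sorry; standard axioms.
-/

set_option autoImplicit false

noncomputable section

open MeasureTheory Filter Topology
open Literature.MathematicalPhysics.QuantumFieldTheory
open Literature.MathematicalPhysics.QuantumLattice
open Summit.QuantumFields.YangMills.Theorems.WeakCouplingRates

namespace Summit.QuantumFields.YangMills.Theorems.ColdBoxAllGroups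

/-! ### PW-CORR-POLY for every compact simple `G` -/

/-- **PW-CORR-POLY(G) under every ceiling.**  For every compact simple `G`, every faithful unitary lattice representation `r` and every
ceiling `θ₀ > 0` there are an exponent `0 < A < θ₀` and `κ > 0` with `PolySeparationPlaquetteFloor 4 r.ρ 1 2 A κ` (volume-uniform floor
`κ β^{-(2+8A)}` under the torus plaquette–plaquette connected correlator at time separation `⌈β^A⌉`, all large `β`): BOX below its own
ceiling `θ₁` (`BoxFloorAllGroups_proof`), BULK under the ceiling `min θ₀ θ₁` (`BulkAllGroups_proof`), FLOOR `curvatureCorrPowerFloor_proof`,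
glue `polySeparationPlaquetteFloor_of_box`.  NOT the Clay gap (a lower bound on correlations). -/
theorem torusPlaquetteFloor_allGroups_ceiling :
    ∀ (G : Type) [Group G] [TopologicalSpace G] [IsTopologicalGroup G] [CompactSpace G],
      IsCompactSimpleLieGroup G →
      letI : MeasurableSpace G := borel G
      haveI : BorelSpace G := ⟨rfl⟩
      ∀ r : LatticeRep G, ∀ θ₀ : ℝ, 0 < θ₀ →
        ∃ A κ : ℝ, 0 < A ∧ A < θ₀ ∧ 0 < κ ∧ PolySeparationPlaquetteFloor 4 r.ρ 1 2 A κ := by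
  intro G _ _ _ _ hG
  letI : MeasurableSpace G := borel G
  haveI : BorelSpace G := ⟨rfl⟩
  show ∀ r : LatticeRep G, ∀ θ₀ : ℝ, 0 < θ₀ →
    ∃ A κ : ℝ, 0 < A ∧ A < θ₀ ∧ 0 < κ ∧ PolySeparationPlaquetteFloor 4 r.ρ 1 2 A κ
  intro r θ₀ hθ₀
  have hb : ∀ r : LatticeRep G, ∃ θ₀ : ℝ, 0 < θ₀ ∧ ∀ A θ : ℝ, 0 < A → A < θ → θ ≤ θ₀ → ∃ c : ℝ, 0 < c ∧
      BoxTwoPointDomination r.ρ A θ c := BoxFloorAllGroups_proof G hG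
  have hk : ∀ r : LatticeRep G, ∀ θ₀ : ℝ, 0 < θ₀ → ∃ A θ : ℝ, 0 < A ∧ A < θ ∧ θ ≤ θ₀ ∧
      BulkDominatesBox r.ρ A θ := BulkAllGroups_proof G hG
  have hF : ∃ κ : ℝ, 0 < κ ∧ ∃ n₀ : ℕ, ∀ n : ℕ, n₀ ≤ n → κ / (n : ℝ) ^ 4 ≤
      |Literature.MathematicalPhysics.QuantumFieldTheory.curvaturePlaquetteCorr (d := 4) (by norm_num) (n : ℤ)| :=
    curvatureCorrPowerFloor_proof
  obtain ⟨θ₁, hθ₁, hbox⟩ := hb r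
  obtain ⟨A, θ, hA, hAθ, hθ, hbulk⟩ := hk r (min θ₀ θ₁) (lt_min hθ₀ hθ₁)
  obtain ⟨c, hc, hB⟩ := hbox A θ hA hAθ (hθ.trans (min_le_right _ _))
  obtain ⟨κ, hκ, hfloor⟩ := polySeparationPlaquetteFloor_of_box r.ρ hA hc hB hbulk hF
  exact ⟨A, κ, hA, hAθ.trans_le (hθ.trans (min_le_left _ _)), hκ, hfloor⟩

/-- **PW-CORR-POLY(G).**  For every compact simple `G` and every faithful unitary lattice representation `r` there are `A, κ > 0` with
`PolySeparationPlaquetteFloor 4 r.ρ 1 2 A κ` — verbatim the hypothesis `H` of `SteinGapBootstrap.SteinBlockTransferG_of_polySeparationFloorAllG`.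
NOT the Clay gap. -/
theorem torusPlaquetteFloor_allGroups :
    ∀ (G : Type) [Group G] [TopologicalSpace G] [IsTopologicalGroup G] [CompactSpace G],
      IsCompactSimpleLieGroup G →
      letI : MeasurableSpace G := borel G
      haveI : BorelSpace G := ⟨rfl⟩
      ∀ r : LatticeRep G, ∃ A κ : ℝ, 0 < A ∧ 0 < κ ∧ PolySeparationPlaquetteFloor 4 r.ρ 1 2 A κ := by
  intro G _ _ _ _ hG
  letI : MeasurableSpace G := borel G
  haveI : BorelSpace G := ⟨rfl⟩
  show ∀ r : LatticeRep G, ∃ A κ : ℝ, 0 < A ∧ 0 < κ ∧ PolySeparationPlaquetteFloor 4 r.ρ 1 2 A κ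
  intro r
  have h : ∀ r : LatticeRep G, ∀ θ₀ : ℝ, 0 < θ₀ →
      ∃ A κ : ℝ, 0 < A ∧ A < θ₀ ∧ 0 < κ ∧ PolySeparationPlaquetteFloor 4 r.ρ 1 2 A κ :=
    torusPlaquetteFloor_allGroups_ceiling G hG
  obtain ⟨A, κ, hA, -, hκ, hfloor⟩ := h r 1 one_pos
  exact ⟨A, κ, hA, hκ, hfloor⟩

/-! ### Dictionary: the rates currency `torusPlaqCov` is the OS-data currency `latticeConnectedCorr` -/

/-- **Dictionary.**  `torusPlaqCov ρ β L T i j` (route `WeakCouplingRates`: Wilson expectation on the torus `Λ_{L+1}` of the lifted product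
`c_p · (c_p ∘ α_T)` minus the product of the lifted means, `α_T` the time shift) equals
`latticeConnectedCorr ρ β (L+1) (plaqCost0 ρ i j) (plaqCost0 ρ i j) T` (`YangMillsOS`: the same with the UNshifted second mean): the two
differ only in the second one-point function, and the torus Wilson state is translation invariant (`integral_comp_configShift_torusLift`). -/
theorem torusPlaqCov_eq_latticeConnectedCorr {G : Type} [Group G] [TopologicalSpace G] [IsTopologicalGroup G] [CompactSpace G]
    [MeasurableSpace G] [BorelSpace G] {N : ℕ} (ρ : G →* Matrix (Fin N) (Fin N) ℂ) (β : ℝ) (L T : ℕ) (i j : Fin 4) :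
    torusPlaqCov (d := 4) ρ β L T i j =
      latticeConnectedCorr ρ β (L + 1) (plaqCost0 ρ i j) (plaqCost0 ρ i j) T := by
  unfold torusPlaqCov latticeConnectedCorr wilsonExpectation
  simp only [toTorusObservable_apply]
  rw [integral_comp_configShift_torusLift ρ β (plaqCost0 ρ i j)]

/-! ### Single-plaquette non-freezing for every compact simple `G` -/

/-- Exponent bookkeeping: for `0 < A`, `1 ≤ β`, with `k = ⌈1/A⌉₊`, the separation `n = ⌈β^A⌉₊` satisfies `β ≤ n^k`. -/
theorem le_ceil_rpow_pow_ceil_inv {β A : ℝ} (hβ : 1 ≤ β) (hA : 0 < A) :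
    β ≤ ((⌈β ^ A⌉₊ : ℕ) : ℝ) ^ (⌈1 / A⌉₊ : ℕ) := by
  have hβ0 : 0 < β := one_pos.trans_le hβ
  have hβA : 0 < β ^ A := Real.rpow_pos_of_pos hβ0 A
  have hk : (1 : ℝ) ≤ A * (⌈1 / A⌉₊ : ℝ) := by
    have h1 : 1 / A ≤ (⌈1 / A⌉₊ : ℝ) := Nat.le_ceil _
    have := mul_le_mul_of_nonneg_left h1 hA.le
    rwa [mul_one_div_cancel hA.ne'] at this
  calc β = β ^ (1 : ℝ) := (Real.rpow_one β).symm
    _ ≤ β ^ (A * (⌈1 / A⌉₊ : ℝ)) := Real.rpow_le_rpow_of_exponent_le hβ hk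
    _ = (β ^ A) ^ ((⌈1 / A⌉₊ : ℕ) : ℝ) := by rw [Real.rpow_mul hβ0.le]
    _ = (β ^ A) ^ (⌈1 / A⌉₊ : ℕ) := Real.rpow_natCast _ _
    _ ≤ ((⌈β ^ A⌉₊ : ℕ) : ℝ) ^ (⌈1 / A⌉₊ : ℕ) := pow_le_pow_left₀ hβA.le (Nat.le_ceil _) _

/-- Exponent bookkeeping: for `1 ≤ β`, `0 ≤ κ` and `p = ⌈2 + 8A⌉₊`, `κ ≤ β^p · (κ β^{-(2+8A)})`. -/
theorem le_pow_mul_rpow_neg {β A κ : ℝ} (hβ : 1 ≤ β) (hκ : 0 ≤ κ) :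
    κ ≤ β ^ (⌈2 + 8 * A⌉₊ : ℕ) * (κ * β ^ (-(2 + 8 * A))) := by
  have hβ0 : 0 < β := one_pos.trans_le hβ
  have hp : 2 + 8 * A ≤ (⌈2 + 8 * A⌉₊ : ℝ) := Nat.le_ceil _
  have h1 : (1 : ℝ) ≤ β ^ ((⌈2 + 8 * A⌉₊ : ℕ) : ℝ) * β ^ (-(2 + 8 * A)) := by
    rw [← Real.rpow_add hβ0]
    exact Real.one_le_rpow hβ (by linarith)
  rw [Real.rpow_natCast] at h1
  calc κ = κ * 1 := (mul_one κ).symm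
    _ ≤ κ * (β ^ (⌈2 + 8 * A⌉₊ : ℕ) * β ^ (-(2 + 8 * A))) := mul_le_mul_of_nonneg_left h1 hκ
    _ = β ^ (⌈2 + 8 * A⌉₊ : ℕ) * (κ * β ^ (-(2 + 8 * A))) := by ring

/-- **Single-plaquette polynomial floor, every compact simple `G`** — the statement `PolynomialFloorWitness` of `SoloInformedNonFreezingFloor`
with the curvature species replaced by the spatial plaquette cost `plaqCost0 r.ρ 1 2` (and `y = 0`), PROVED: there are `k p : ℕ` and `c > 0`
such that for all large `β`, on every large torus of side `2S+1`, the origin `(1,2)`-plaquette and its time-translate by some `n ≤ S` with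
`β ≤ n^k` have truncated correlation `≥ c β^{-p}` in modulus (`n = ⌈β^A⌉`, `k = ⌈1/A⌉`, `p = ⌈2+8A⌉`, `c = κ` of PW-CORR-POLY(G)).
NOT the Clay gap. -/
theorem plaquettePolynomialFloor_allGroups :
    ∀ (G : Type) [Group G] [TopologicalSpace G] [IsTopologicalGroup G] [CompactSpace G],
      IsCompactSimpleLieGroup G →
      letI : MeasurableSpace G := borel G
      haveI : BorelSpace G := ⟨rfl⟩
      ∀ r : LatticeRep G, ∃ (k p : ℕ) (c : ℝ), 0 < c ∧
        ∃ β₁ : ℝ, ∀ β : ℝ, β₁ ≤ β → ∃ S₁ : ℕ, ∀ S : ℕ, S₁ ≤ S →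
          ∃ n : ℕ, β ≤ (n : ℝ) ^ k ∧ n ≤ S ∧
            c ≤ β ^ p * |latticeConnectedCorr r.ρ β (2 * S + 1) (plaqCost0 r.ρ 1 2) (plaqCost0 r.ρ 1 2) n| := by
  intro G _ _ _ _ hG
  letI : MeasurableSpace G := borel G
  haveI : BorelSpace G := ⟨rfl⟩
  show ∀ r : LatticeRep G, ∃ (k p : ℕ) (c : ℝ), 0 < c ∧
    ∃ β₁ : ℝ, ∀ β : ℝ, β₁ ≤ β → ∃ S₁ : ℕ, ∀ S : ℕ, S₁ ≤ S →
      ∃ n : ℕ, β ≤ (n : ℝ) ^ k ∧ n ≤ S ∧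
        c ≤ β ^ p * |latticeConnectedCorr r.ρ β (2 * S + 1) (plaqCost0 r.ρ 1 2) (plaqCost0 r.ρ 1 2) n|
  intro r
  have h : ∀ r : LatticeRep G, ∃ A κ : ℝ, 0 < A ∧ 0 < κ ∧ PolySeparationPlaquetteFloor 4 r.ρ 1 2 A κ :=
    torusPlaquetteFloor_allGroups G hG
  obtain ⟨A, κ, hA, hκ, β₀, hfloor⟩ := h r
  refine ⟨⌈1 / A⌉₊, ⌈2 + 8 * A⌉₊, κ, hκ, max β₀ 1, fun β hβ => ?_⟩
  have hβ0 : β₀ ≤ β := (le_max_left _ _).trans hβ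
  have hβ1 : (1 : ℝ) ≤ β := (le_max_right _ _).trans hβ
  -- the floor at `β`, eventually in the torus size `L + 1`
  obtain ⟨L₀, hL₀⟩ := eventually_atTop.1 (hfloor β hβ0)
  set n : ℕ := ⌈β ^ A⌉₊ with hn
  refine ⟨max L₀ n, fun S hS => ⟨n, le_ceil_rpow_pow_ceil_inv hβ1 hA, (le_max_right _ _).trans hS, ?_⟩⟩
  have hL : L₀ ≤ 2 * S := ((le_max_left _ _).trans hS).trans (by omega)
  -- the floor on the torus of side `2S + 1`, read in the OS-data currency
  have hfl : κ * β ^ (-(2 + 8 * A)) ≤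
      latticeConnectedCorr r.ρ β (2 * S + 1) (plaqCost0 r.ρ 1 2) (plaqCost0 r.ρ 1 2) n := by
    have h2 : κ * β ^ (-(2 + 8 * A)) ≤ torusPlaqCov (d := 4) r.ρ β (2 * S) n 1 2 := hL₀ (2 * S) hL
    rwa [torusPlaqCov_eq_latticeConnectedCorr] at h2
  have hpos : 0 ≤ latticeConnectedCorr r.ρ β (2 * S + 1) (plaqCost0 r.ρ 1 2) (plaqCost0 r.ρ 1 2) n :=
    le_trans (by positivity) hfl
  rw [abs_of_nonneg hpos]
  exact (le_pow_mul_rpow_neg hβ1 hκ.le).trans (mul_le_mul_of_nonneg_left hfl (by positivity))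

/-- **Single-plaquette lattice non-freezing, every compact simple `G`** — the statement `LatticeNonFreezing` of `SoloInformedNonFreezing`
(Chatterjee 2019 Problem 5.1, second half, volume-uniform clustering form) with the curvature species `r.curvature.F` (six-plane action
density) replaced by the single spatial plaquette cost `plaqCost0 r.ρ 1 2`, PROVED: for every `C` and every rate `μ > 0`, for all large `β`, on
EVERY large periodic torus of side `2S+1`, some time-translate (by `n ≤ S`) of the origin `(1,2)`-plaquette has truncated correlation with it
`> C e^{-μ n}` — no fixed exponential rate clusters the spatial plaquette field at all large `β`, uniformly in the volume.  (The six-plane node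
itself is NOT claimed: see the module docstring.)  NOT the Clay gap. -/
theorem plaquetteNonFreezing_allGroups :
    ∀ (G : Type) [Group G] [TopologicalSpace G] [IsTopologicalGroup G] [CompactSpace G],
      IsCompactSimpleLieGroup G →
      letI : MeasurableSpace G := borel G
      haveI : BorelSpace G := ⟨rfl⟩
      ∀ (r : LatticeRep G) (C μ : ℝ), 0 < μ →
        ∃ β₀ : ℝ, ∀ β : ℝ, β₀ ≤ β → ∃ S₀ : ℕ, ∀ S : ℕ, S₀ ≤ S →
          ∃ n : ℕ, n ≤ S ∧
            C * Real.exp (-(μ * n)) <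
              |latticeConnectedCorr r.ρ β (2 * S + 1) (plaqCost0 r.ρ 1 2) (plaqCost0 r.ρ 1 2) n| := by
  intro G _ _ _ _ hG
  letI : MeasurableSpace G := borel G
  haveI : BorelSpace G := ⟨rfl⟩
  show ∀ (r : LatticeRep G) (C μ : ℝ), 0 < μ →
    ∃ β₀ : ℝ, ∀ β : ℝ, β₀ ≤ β → ∃ S₀ : ℕ, ∀ S : ℕ, S₀ ≤ S →
      ∃ n : ℕ, n ≤ S ∧
        C * Real.exp (-(μ * n)) <
          |latticeConnectedCorr r.ρ β (2 * S + 1) (plaqCost0 r.ρ 1 2) (plaqCost0 r.ρ 1 2) n|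
  intro r C μ hμ
  -- adapted from `latticeNonFreezing_of_polynomialFloor` (`SoloInformedNonFreezingFloor`), with the single-plaquette floor as input
  have hW : ∀ r : LatticeRep G, ∃ (k p : ℕ) (c : ℝ), 0 < c ∧
      ∃ β₁ : ℝ, ∀ β : ℝ, β₁ ≤ β → ∃ S₁ : ℕ, ∀ S : ℕ, S₁ ≤ S →
        ∃ n : ℕ, β ≤ (n : ℝ) ^ k ∧ n ≤ S ∧
          c ≤ β ^ p * |latticeConnectedCorr r.ρ β (2 * S + 1) (plaqCost0 r.ρ 1 2) (plaqCost0 r.ρ 1 2) n| :=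
    plaquettePolynomialFloor_allGroups G hG
  obtain ⟨k, p, c, hc, β₁, hβ₁⟩ := hW r
  obtain ⟨N₀, hN₀⟩ := exists_nat_pow_mul_exp_neg_lt C μ c hμ hc (k * p)
  refine ⟨max β₁ ((N₀ : ℝ) ^ k + 1), fun β hβ => ?_⟩
  have hβ₁' : β₁ ≤ β := le_trans (le_max_left _ _) hβ
  have hβN : (N₀ : ℝ) ^ k + 1 ≤ β := le_trans (le_max_right _ _) hβ
  have hN0 : (0 : ℝ) ≤ (N₀ : ℝ) ^ k := by positivity
  have hβpos : 0 < β := by linarith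
  obtain ⟨S₁, hS₁⟩ := hβ₁ β hβ₁'
  refine ⟨S₁, fun S hS => ?_⟩
  obtain ⟨n, hsep, hnS, hfloor⟩ := hS₁ S hS
  refine ⟨n, hnS, ?_⟩
  have hNn : N₀ ≤ n := by
    have h1 : (N₀ : ℝ) ^ k < (n : ℝ) ^ k := by linarith
    have h2 : (N₀ : ℝ) < n := lt_of_pow_lt_pow_left₀ k (Nat.cast_nonneg n) h1
    exact_mod_cast h2.le
  have hmain : C * (n : ℝ) ^ (k * p) * Real.exp (-(μ * n)) < c := hN₀ n hNn
  have hβp : β ^ p ≤ (n : ℝ) ^ (k * p) := by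
    rw [pow_mul]; exact pow_le_pow_left₀ hβpos.le hsep p
  have hβppos : 0 < β ^ p := pow_pos hβpos p
  generalize hX : |latticeConnectedCorr r.ρ β (2 * S + 1) (plaqCost0 r.ρ 1 2) (plaqCost0 r.ρ 1 2) n| = X
    at hfloor ⊢
  by_contra hcon
  push Not at hcon
  have h1 : c ≤ β ^ p * (C * Real.exp (-(μ * n))) :=
    hfloor.trans (mul_le_mul_of_nonneg_left hcon hβppos.le)
  rcases le_or_gt 0 C with hC | hC
  · have hCe : 0 ≤ C * Real.exp (-(μ * n)) := mul_nonneg hC (Real.exp_pos _).le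
    have h2 : β ^ p * (C * Real.exp (-(μ * n))) ≤ (n : ℝ) ^ (k * p) * (C * Real.exp (-(μ * n))) :=
      mul_le_mul_of_nonneg_right hβp hCe
    have h3 : (n : ℝ) ^ (k * p) * (C * Real.exp (-(μ * n))) = C * (n : ℝ) ^ (k * p) * Real.exp (-(μ * n)) := by
      ring
    linarith
  · have hCe : C * Real.exp (-(μ * n)) < 0 := mul_neg_of_neg_of_pos hC (Real.exp_pos _)
    have h2 : β ^ p * (C * Real.exp (-(μ * n))) < 0 := mul_neg_of_pos_of_neg hβppos hCe
    linarith

/-- The same in the EXACT binder shape of `LatticeNonFreezing` (a time shift `n ≤ S` and a spatial shift `y` with `y 0 = 0`, here `y = 0`),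
with `r.curvature.F` replaced by `plaqCost0 r.ρ 1 2`.  NOT the six-plane node; NOT the Clay gap. -/
theorem plaquetteNonFreezing_allGroups' :
    ∀ (G : Type) [Group G] [TopologicalSpace G] [IsTopologicalGroup G] [CompactSpace G],
      IsCompactSimpleLieGroup G →
      letI : MeasurableSpace G := borel G
      haveI : BorelSpace G := ⟨rfl⟩
      ∀ (r : LatticeRep G) (C μ : ℝ), 0 < μ →
        ∃ β₀ : ℝ, ∀ β : ℝ, β₀ ≤ β → ∃ S₀ : ℕ, ∀ S : ℕ, S₀ ≤ S →
          ∃ (n : ℕ) (y : Literature.Probability.LatticeModels.Site 4), n ≤ S ∧ y 0 = 0 ∧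
            C * Real.exp (-(μ * n)) <
              |latticeConnectedCorr r.ρ β (2 * S + 1) (plaqCost0 r.ρ 1 2)
                (fun U => plaqCost0 r.ρ 1 2 (configShift (-y) U)) n| := by
  intro G _ _ _ _ hG
  letI : MeasurableSpace G := borel G
  haveI : BorelSpace G := ⟨rfl⟩
  show ∀ (r : LatticeRep G) (C μ : ℝ), 0 < μ →
    ∃ β₀ : ℝ, ∀ β : ℝ, β₀ ≤ β → ∃ S₀ : ℕ, ∀ S : ℕ, S₀ ≤ S →
      ∃ (n : ℕ) (y : Literature.Probability.LatticeModels.Site 4), n ≤ S ∧ y 0 = 0 ∧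
        C * Real.exp (-(μ * n)) <
          |latticeConnectedCorr r.ρ β (2 * S + 1) (plaqCost0 r.ρ 1 2)
            (fun U => plaqCost0 r.ρ 1 2 (configShift (-y) U)) n|
  intro r C μ hμ
  have h : ∀ (r : LatticeRep G) (C μ : ℝ), 0 < μ →
      ∃ β₀ : ℝ, ∀ β : ℝ, β₀ ≤ β → ∃ S₀ : ℕ, ∀ S : ℕ, S₀ ≤ S →
        ∃ n : ℕ, n ≤ S ∧
          C * Real.exp (-(μ * n)) <
            |latticeConnectedCorr r.ρ β (2 * S + 1) (plaqCost0 r.ρ 1 2) (plaqCost0 r.ρ 1 2) n| :=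
    plaquetteNonFreezing_allGroups G hG
  obtain ⟨β₀, hβ₀⟩ := h r C μ hμ
  refine ⟨β₀, fun β hβ => ?_⟩
  obtain ⟨S₀, hS₀⟩ := hβ₀ β hβ
  refine ⟨S₀, fun S hS => ?_⟩
  obtain ⟨n, hnS, hlt⟩ := hS₀ S hS
  have hshift : (fun U : LGConfig 4 G => plaqCost0 r.ρ 1 2 (configShift (-(0 : Literature.Probability.LatticeModels.Site 4)) U)) =
      plaqCost0 r.ρ 1 2 := by
    funext U
    congr 1
    funext e
    simp
  exact ⟨n, 0, hnS, rfl, by rwa [hshift]⟩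

end Summit.QuantumFields.YangMills.Theorems.ColdBoxAllGroups

end
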